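/-
COR-CM (cell pub-hodgecm2) — GEOMETRY SIDE OF THE HECKE CORRESPONDENCES OF THE REALISING PICARD MODULAR SURFACES:
the normal-core level, the Hecke translate as a finite covering, the Galois level cover and the Hodge-compatibility of
its transfer operators.  Lane «L-BYPASS LEAVES» (b10 gen 22): the CorCM junction of the generic Literature leaves
`CompactOpenNormalCore` (p321186), `UnitaryBallHeckeTranslateFiniteCover` (p320917), `FiniteCoverTransferComparison`
(p320714) and b26's `UnitaryBallLevelDeckCover`; kernel text by the seat pub-hodgecm2-s2crux-idea-2 (probes RA-v18 /
RA-v27 Part F2 / RA-v29, gens 7–8), filed by b10.  Count-neutral: no BINDER-OWNERS row, nothing under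
`B01/Transposition`, Interfaces (C1) / E term untouched.  HC_CM is NOT proved; B01-S is NOT discharged; this file
inhabits no binder of the END display.
-/
import Summits.HodgeConjecture.CorCM.B01.HeckePair
import Summits.HodgeConjecture.CorCM.AlbaneseSideModelMatch
import Literature.AlgebraicGeometry.ShimuraVarieties.UnitaryBallLevelDeckCover
import Literature.AlgebraicGeometry.ShimuraVarieties.UnitaryBallHeckeTranslateFiniteCover
import Literature.AlgebraicGeometry.HodgeTheory.BettiUniverseAxioms
import Literature.AlgebraicGeometry.Motives.HodgeStructurePolarizationNormalSemisimple
import Literature.NumberTheory.Automorphic.CompactOpenNormalCore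
import HarnessLib

set_option autoImplicit false

/-!
# Hecke correspondences of the realising Picard modular surfaces: levels, coverings, Hodge-compatibility

For the realising surfaces `X_Γ = Var.scheme hU h₃ (.pms (pmsCode L ι₁ V Γ))` of the model universe (compact ball
quotients attached to torsion-free levels `Γ : Level V` of an anisotropic hermitian `3`-space `V` over the CM field `L`,
uniformised by `Var.ballDatum`), this file records:

* §1 `Level.core Γ Γ'` — the NORMAL-CORE LEVEL `(Γ(K_N), K_N)`, `K_N` the normal core of `K'` in `K`
  (`Subgroup.coreIn`, `Literature/NumberTheory/Automorphic/CompactOpenNormalCore`): a level `≤ Γ`, `≤ Γ'` whose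
  arithmetic group is NORMAL OF FINITE INDEX in `Γ.Γ` (`normal_core_Γ_subgroupOf`, `finiteIndex_core_Γ_subgroupOf`) — the
  Galois intermediate level of a Hecke pair; no hypothesis beyond the data.
* §2 `Model.isFiniteCover_mapContinuous_of_map_unif_mulVec`, `exists_heckeTranslate_isFiniteCover` — any morphism
  `g : X_{Γ'} ⟶ X_Γ` lying over `v ↦ γ^{ι₁} v` on the negative cone (`γ ∈ U(V)(L)`; the Hecke translate of the tree's
  `exists_heckeTranslate`) is a FINITE COVERING on complex points (`UnitaryBallHeckeTranslateFiniteCover`).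
* §3 `Model.normal_map_Γ`, `fintypeDeckGroup`, `exists_levelDeckCover_hodge_ballDatum`,
  `exists_heckeOperator_mem_endAlg_ballDatum` — for levels `Γ' ≤ Γ` with `Γ'^{ι₁} ⊴ Γ^{ι₁}` of finite index: the level
  morphism `f : X_{Γ'} ⟶ X_Γ` is a finite GALOIS covering on complex points with deck group `Γ^{ι₁}/Γ'^{ι₁}` acting by
  `[γ]·[v] = [γ v]`, and for EVERY `f₂ : X_{Γ'} ⟶ X_Γ` the operator `τ_c ∘ f₂^*` (deck transfer after pull-back) is a
  HODGE ENDOMORPHISM of `Hᵏ(X_Γ(ℂ); ℚ)` for the Hodge structure of record `BettiUniverse.hodge` (b26's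
  `UnitaryBallLevelDeckCover.exists_finiteDeckCover_transferMap_hodge` on the CorCM ball data); in particular the
  Hecke-shaped operators `τ_c ∘ g^*`; and `isSemisimple_of_mem_endAlg_pms`: a Hodge endomorphism with a commuting
  adjoint for a polarisation is semisimple (tree `Polarization.isSemisimple_of_isAdjointPair_of_commute`).

References: G. Shimura, *Introduction to the Arithmetic Theory of Automorphic Functions* (1971), Ch. 3 §3.1–3.4 and
§7.2–7.3 [Shimura1971] / [ShimuraIATAF1971]; N. Bergeron, J. Millson, C. Moeglin, Acta Math. 216 (2016), Part 2 §1.8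
[BergeronMillsonMoeglin2016Balls]; A. Hatcher, *Algebraic Topology* (2002), §1.3, §3.G [HatcherAT2002]; H. Lange,
*Abelian Varieties over the Complex Numbers* (2023), §2.4.1 [Lange2023AbelianVarietiesC].
-/

noncomputable section

/-! ## §1 The normal-core level -/

namespace Summit.HodgeConjecture.CorCM

open NumberField Literature.NumberTheory.Automorphic

namespace Level

variable {L : CMField} {ι₁ : L →+* ℂ} {V : HermSpace3 L ι₁}

/-- **The normal-core level** `Γ.core Γ' := (Γ(K_N), K_N)`, `K_N` the normal core of `K'` in `K`:
a level `≤ Γ ⊓ Γ'` whose arithmetic group is NORMAL OF FINITE INDEX in `Γ.Γ`.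
[cite: ShimuraIATAF1971, Ch. 3 §3.1 and §3.3] -/
noncomputable def core (Γ Γ' : Level V) : Level V where
  Γ := UnitaryGroup.arithmeticLevel (↥(maximalRealSubfield L)) L (IsCMField.complexConj L) 3 V.Hm (Γ.K.coreIn Γ'.K)
  K := Γ.K.coreIn Γ'.K
  isCompact_K := Subgroup.isCompact_coreIn Γ.isCompact_K Γ.isOpen_K Γ'.isOpen_K
  isOpen_K := Subgroup.isOpen_coreIn Γ.isCompact_K Γ.isOpen_K Γ'.isOpen_K
  arithmeticLevel_K := rfl
  torsionFree δ hδ hfin := Γ'.torsionFree δ (by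
    have h := UnitaryGroup.arithmeticLevel_mono (F := ↥(maximalRealSubfield L)) (E := L)
      (c := IsCMField.complexConj L) (N := 3) (J := V.Hm) (Subgroup.coreIn_le_right Γ.K Γ'.K) hδ
    rwa [Γ'.arithmeticLevel_K] at h) hfin

variable (Γ Γ' : Level V)

/-- The compact open subgroup of `Γ.core Γ'` is the normal core `coreIn K K'`. [folklore] -/
theorem core_K : (Γ.core Γ').K = Γ.K.coreIn Γ'.K := rfl

/-- `Γ.core Γ' ≤ Γ` (in the `K`-order). [folklore] -/
theorem core_le_left : Γ.core Γ' ≤ Γ := Subgroup.coreIn_le_left _ _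

/-- `Γ.core Γ' ≤ Γ'` (in the `K`-order). [folklore] -/
theorem core_le_right : Γ.core Γ' ≤ Γ' := Subgroup.coreIn_le_right _ _

/-- `Γ_N ≤ Γ` in `GL₃(L)`. [folklore] -/
theorem core_Γ_le_left : (Γ.core Γ').Γ ≤ Γ.Γ := Level.Γ_mono (core_le_left Γ Γ')

/-- `Γ_N ≤ Γ'` in `GL₃(L)`. [folklore] -/
theorem core_Γ_le_right : (Γ.core Γ').Γ ≤ Γ'.Γ := Level.Γ_mono (core_le_right Γ Γ')

/-- **`Γ_N ⊴ Γ`.** [folklore] -/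
instance normal_core_Γ_subgroupOf : ((Γ.core Γ').Γ.subgroupOf Γ.Γ).Normal := by
  have h := UnitaryGroup.normal_arithmeticLevel_coreIn_subgroupOf (F := ↥(maximalRealSubfield L)) (E := L)
    (c := IsCMField.complexConj L) (N := 3) (J := V.Hm) Γ.K Γ'.K
  rwa [Γ.arithmeticLevel_K] at h

/-- **`[Γ : Γ_N] < ∞`.** [folklore] -/
instance finiteIndex_core_Γ_subgroupOf : ((Γ.core Γ').Γ.subgroupOf Γ.Γ).FiniteIndex := by
  haveI : (Γ'.K.subgroupOf Γ.K).FiniteIndex :=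
    Literature.NumberTheory.Automorphic.Subgroup.finiteIndex_subgroupOf_of_isCompact_isOpen Γ.isCompact_K Γ'.isOpen_K
  have h := UnitaryGroup.finiteIndex_arithmeticLevel_coreIn_subgroupOf (F := ↥(maximalRealSubfield L)) (E := L)
    (c := IsCMField.complexConj L) (N := 3) (J := V.Hm) Γ.K Γ'.K
  rwa [Γ.arithmeticLevel_K] at h

/-- `γ Γ_N γ⁻¹ ≤ Γ_N` for `γ ∈ Γ` (membership form of normality). [folklore] -/
theorem conj_mem_core_Γ {γ δ : GL (Fin 3) L} (hγ : γ ∈ Γ.Γ) (hδ : δ ∈ (Γ.core Γ').Γ) :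
    γ * δ * γ⁻¹ ∈ (Γ.core Γ').Γ := by
  have h := (normal_core_Γ_subgroupOf Γ Γ').conj_mem ⟨δ, core_Γ_le_left Γ Γ' hδ⟩
    (Subgroup.mem_subgroupOf.mpr hδ) ⟨γ, hγ⟩
  exact Subgroup.mem_subgroupOf.mp h

end Level

end Summit.HodgeConjecture.CorCM

/-! ## §2 The Hecke translate of the Picard modular tower is a finite covering -/

open CategoryTheory Matrix
open Literature.AlgebraicGeometry.Motives (SchemeOver ComplexPoints AlgPoints bettiCohomology)
open Literature.AlgebraicGeometry.HodgeTheory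
open Literature.AlgebraicGeometry.ShimuraVarieties
open Literature.AlgebraicTopology.SingularHomology

namespace Summit.HodgeConjecture.CorCM.Model

open NumberField
open Literature.NumberTheory.Automorphic
open Literature.NumberTheory.Automorphic.PicardCM

section HeckeFiniteCover

variable {hU : BallQuotientUniformisedDatum} {h₃ : CMAbelianVarietyRealised}
variable {L : CMField} {ι₁ : L →+* ℂ} {V : HermSpace3 L ι₁}

/-- **(G-fin) Any morphism `g : X_{Γ'} ⟶ X_Γ` of the realising schemes lying over `v ↦ γ^{ι₁} v` on the negative
cone (`γ ∈ U(V₃,h)(L)`; e.g. the Hecke translate of `exists_heckeTranslate`) is a finite covering on complex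
points** — same Gram matrix (`ballDatum_Hℂ_eq`), `γ^{ι₁} ∈ U(H^{τ₁})` (`map_ι₁_mem_realPoints_ballDatum`), frame
transport. [cite: BergeronMillsonMoeglin2016Balls, Part 2 §1.8] [cite: Shimura1971, §7.2–7.3] -/
theorem isFiniteCover_mapContinuous_of_map_unif_mulVec {Γ Γ' : Level V} {γ : GL (Fin 3) L}
    (hγ : γ ∈ unitaryGroup (cmConjRingHom L) V.Hm)
    (h' : (pmsCode L ι₁ V Γ').IsAnisotropic) (h : (pmsCode L ι₁ V Γ).IsAnisotropic)
    {g : Var.scheme hU h₃ (.pms (pmsCode L ι₁ V Γ')) ⟶ Var.scheme hU h₃ (.pms (pmsCode L ι₁ V Γ))}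
    (hg : ∀ v ∈ (Var.ballDatum hU h₃ (pmsCode L ι₁ V Γ') h').cone,
      AlgPoints.map g ((Var.ballDatum hU h₃ (pmsCode L ι₁ V Γ') h').unif v) =
        (Var.ballDatum hU h₃ (pmsCode L ι₁ V Γ) h).unif (((γ : Matrix (Fin 3) (Fin 3) L).map ι₁) *ᵥ v)) :
    IsFiniteCover (AlgPoints.mapContinuous (L := ℂ) g) :=
  UnitaryBallUniformisationDatum.isFiniteCover_of_unif_mulVec_of_mem_realPoints
    (ballDatum_Hℂ_eq hU h₃ Γ Γ' h' h) (map_ι₁_mem_realPoints_ballDatum hU h₃ Γ h hγ)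
    (AlgPoints.mapContinuous (L := ℂ) g) (fun v hv => hg v hv)

/-- **The Hecke translate exists AND is a finite covering** (`exists_heckeTranslate` + (G-fin)).
[cite: Shimura1971, §7.2–7.3] [cite: BergeronMillsonMoeglin2016Balls, Part 2 §1.8] -/
theorem exists_heckeTranslate_isFiniteCover (hHD : exists_isReal_hodgeModel) {Γ Γ' : Level V} {γ : GL (Fin 3) L}
    (hγ : γ ∈ unitaryGroup (cmConjRingHom L) V.Hm) (hconj : Γ'.Γ.map (MulAut.conj γ).toMonoidHom ≤ Γ.Γ)
    (h' : (pmsCode L ι₁ V Γ').IsAnisotropic) (h : (pmsCode L ι₁ V Γ).IsAnisotropic) :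
    ∃ (g : Var.scheme hU h₃ (.pms (pmsCode L ι₁ V Γ')) ⟶ Var.scheme hU h₃ (.pms (pmsCode L ι₁ V Γ)))
      (_ : IsFiniteCover (AlgPoints.mapContinuous (L := ℂ) g)),
      ∀ v ∈ (Var.ballDatum hU h₃ (pmsCode L ι₁ V Γ') h').cone,
        AlgPoints.map g ((Var.ballDatum hU h₃ (pmsCode L ι₁ V Γ') h').unif v) =
          (Var.ballDatum hU h₃ (pmsCode L ι₁ V Γ) h).unif (((γ : Matrix (Fin 3) (Fin 3) L).map ι₁) *ᵥ v) := by
  obtain ⟨g, hg⟩ := exists_heckeTranslate hU h₃ hHD hγ hconj h' h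
  exact ⟨g, isFiniteCover_mapContinuous_of_map_unif_mulVec hγ h' h hg, hg⟩

end HeckeFiniteCover

end Summit.HodgeConjecture.CorCM.Model

/-! ## §3 The Galois level cover of the realising surfaces and the Hodge-compatibility of its transfers -/

open Literature.NumberTheory.Transcendental (Arapura2012_Cor_15_4_6 arapura2012_cor_15_4_6_holds)

/-! ### Group-theoretic transport along a homomorphism -/

/-- Relative normality passes to images under a group homomorphism (deliberate dot-notation extension of Mathlib's
`Subgroup.Normal`). [folklore] -/
theorem Subgroup.Normal.subgroupOf_map {G G' : Type*} [Group G] [Group G'] (f : G →* G')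
    {A B : Subgroup G} (hAB : A ≤ B) (hN : (A.subgroupOf B).Normal) :
    ((A.map f).subgroupOf (B.map f)).Normal := by
  rw [Subgroup.normal_subgroupOf_iff (Subgroup.map_mono hAB)]
  rw [Subgroup.normal_subgroupOf_iff hAB] at hN
  rintro _ _ ⟨a, ha, rfl⟩ ⟨b, hb, rfl⟩
  exact ⟨b * a * b⁻¹, hN a b ha hb, by simp only [map_mul, map_inv]⟩

/-- Finite relative index passes to images under an injective group homomorphism (deliberate dot-notation extension
of Mathlib's `Subgroup.FiniteIndex`). [folklore] -/
theorem Subgroup.FiniteIndex.subgroupOf_map_of_injective {G G' : Type*} [Group G] [Group G'] {f : G →* G'}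
    (hf : Function.Injective f) (A B : Subgroup G) [hF : (A.subgroupOf B).FiniteIndex] :
    ((A.map f).subgroupOf (B.map f)).FiniteIndex := by
  refine ⟨?_⟩
  change Subgroup.relIndex _ _ ≠ 0
  rw [Subgroup.relIndex_map_map_of_injective A B hf]
  exact hF.index_ne_zero

/-- … hence the relative quotient of the images is a finite type (the deck group of a Galois level cover; deliberate
dot-notation extension of Mathlib's `Subgroup`). [folklore] -/
@[reducible] noncomputable def Subgroup.fintypeQuotientSubgroupOfMap {G G' : Type*} [Group G] [Group G'] {f : G →* G'}
    (hf : Function.Injective f) (A B : Subgroup G) [(A.subgroupOf B).FiniteIndex] :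
    Fintype (↥(B.map f) ⧸ (A.map f).subgroupOf (B.map f)) :=
  haveI := Subgroup.FiniteIndex.subgroupOf_map_of_injective hf A B
  Subgroup.fintypeQuotientOfFiniteIndex

namespace Summit.HodgeConjecture.CorCM.Model

open NumberField
open Literature.NumberTheory.Automorphic
open Literature.NumberTheory.Automorphic.PicardCM

section Tower

variable {hU : BallQuotientUniformisedDatum} {h₃ : CMAbelianVarietyRealised}
variable {L : CMField} {ι₁ : L →+* ℂ} {V : HermSpace3 L ι₁}

/-! ### The inputs of `UnitaryBallLevelDeckCover` on the CorCM ball data (`Model.ballDatum_pmsCode_map_Γ` is the tree's) -/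

/-- `GL₃(ι₁)` is injective (the tree's `Literature.NumberTheory.Automorphic.generalLinearGroup_map_injective` at
`ι₁`, restated to keep the `IwahoriGL` import out of this file). [folklore] -/
private theorem generalLinearGroup_map_injective :
    Function.Injective (Matrix.GeneralLinearGroup.map (n := Fin 3) ι₁) := by
  intro a b hab
  ext i j
  have hij := congrArg (fun g : GL (Fin 3) ℂ => (g : Matrix (Fin 3) (Fin 3) ℂ) i j) hab
  exact ι₁.injective hij

/-- Normality of `Γ'^{ι₁} ⊴ Γ^{ι₁}` in `GL₃(ℂ)` from `Γ' ⊴ Γ` in `GL₃(L)`. [folklore] -/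
theorem normal_map_Γ {Γ Γ' : Level V} (hle : Γ'.Γ ≤ Γ.Γ) (hN : (Γ'.Γ.subgroupOf Γ.Γ).Normal) :
    ((Γ'.Γ.map (Matrix.GeneralLinearGroup.map ι₁)).subgroupOf
      (Γ.Γ.map (Matrix.GeneralLinearGroup.map ι₁))).Normal :=
  hN.subgroupOf_map _ hle

/-- The deck group `Γ^{ι₁} / Γ'^{ι₁}` is finite when `Γ'` has finite index in `Γ`. [folklore] -/
@[reducible] noncomputable def fintypeDeckGroup (Γ Γ' : Level V) [(Γ'.Γ.subgroupOf Γ.Γ).FiniteIndex] :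
    Fintype (↥(Γ.Γ.map (Matrix.GeneralLinearGroup.map ι₁)) ⧸
      (Γ'.Γ.map (Matrix.GeneralLinearGroup.map ι₁)).subgroupOf (Γ.Γ.map (Matrix.GeneralLinearGroup.map ι₁))) :=
  Subgroup.fintypeQuotientSubgroupOfMap generalLinearGroup_map_injective Γ'.Γ Γ.Γ

/-! ### The Galois level cover and Hodge-compatibility of its transfer operators -/

/-- **The Galois level cover of the realising Picard modular surfaces and the Hodge-compatibility of its
Hecke-shaped operators** (`UnitaryBallLevelDeckCover.exists_finiteDeckCover_transferMap_hodge` applied to the CorCM ball data).  For levels `Γ' ≤ Γ` of one anisotropic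
hermitian space with `Γ'^{ι₁} ⊴ Γ^{ι₁}` and finite deck group: a level morphism `f : X_{Γ'} ⟶ X_Γ` over
`[v] ↦ [v]`, a deck action of `Γ^{ι₁}/Γ'^{ι₁}` on `X_{Γ'}(ℂ)` and a `FiniteDeckCover` `c` with `c.proj = f(ℂ)`,
such that `τ_c ∘ f₂^* ∈ End_Hdg(Hᵏ(X_Γ(ℂ); ℚ))` of record for every `f₂ : X_{Γ'} ⟶ X_Γ`, and the decks act by
`[γ] · [v] = [γ v]`. [cite: BergeronMillsonMoeglin2016Balls, Part 2 §1.8] [cite: Shimura1971, §7.2–7.3]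
[cite: HatcherAT2002, §3.G] -/
theorem exists_levelDeckCover_hodge_ballDatum (hHD : exists_isReal_hodgeModel)
    (hI : hodgePQ_independent_of_hodgeModel) {Γ Γ' : Level V} (hle : Γ'.Γ ≤ Γ.Γ)
    (h' : (pmsCode L ι₁ V Γ').IsAnisotropic) (h : (pmsCode L ι₁ V Γ).IsAnisotropic)
    [hN : ((Γ'.Γ.map (Matrix.GeneralLinearGroup.map ι₁)).subgroupOf
      (Γ.Γ.map (Matrix.GeneralLinearGroup.map ι₁))).Normal]
    [Fintype (↥(Γ.Γ.map (Matrix.GeneralLinearGroup.map ι₁)) ⧸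
      (Γ'.Γ.map (Matrix.GeneralLinearGroup.map ι₁)).subgroupOf (Γ.Γ.map (Matrix.GeneralLinearGroup.map ι₁)))] :
    ∃ (f : Var.scheme hU h₃ (.pms (pmsCode L ι₁ V Γ')) ⟶ Var.scheme hU h₃ (.pms (pmsCode L ι₁ V Γ)))
      (_ : MulAction (↥(Γ.Γ.map (Matrix.GeneralLinearGroup.map ι₁)) ⧸
          (Γ'.Γ.map (Matrix.GeneralLinearGroup.map ι₁)).subgroupOf (Γ.Γ.map (Matrix.GeneralLinearGroup.map ι₁)))
        (ComplexPoints (Var.scheme hU h₃ (.pms (pmsCode L ι₁ V Γ')))))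
      (c : FiniteDeckCover (↥(Γ.Γ.map (Matrix.GeneralLinearGroup.map ι₁)) ⧸
          (Γ'.Γ.map (Matrix.GeneralLinearGroup.map ι₁)).subgroupOf (Γ.Γ.map (Matrix.GeneralLinearGroup.map ι₁)))
        (ComplexPoints (Var.scheme hU h₃ (.pms (pmsCode L ι₁ V Γ'))))
        (ComplexPoints (Var.scheme hU h₃ (.pms (pmsCode L ι₁ V Γ))))),
      (∀ v ∈ (Var.ballDatum hU h₃ (pmsCode L ι₁ V Γ') h').cone,
        AlgPoints.map f ((Var.ballDatum hU h₃ (pmsCode L ι₁ V Γ') h').unif v) =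
          (Var.ballDatum hU h₃ (pmsCode L ι₁ V Γ) h).unif v) ∧
      c.proj = AlgPoints.mapContinuous (L := ℂ) f ∧
      (∀ (k : ℕ) (f₂ : Var.scheme hU h₃ (.pms (pmsCode L ι₁ V Γ')) ⟶ Var.scheme hU h₃ (.pms (pmsCode L ι₁ V Γ))),
        (c.transferMap (R := ℚ) k).hom ∘ₗ BettiUniverse.pull f₂ k ∈
          (BettiUniverse.hodge hHD (Var.isSmoothProjective hU h₃ (.pms (pmsCode L ι₁ V Γ))) k).endAlg) ∧
      ∀ (γ : ↥(Γ.Γ.map (Matrix.GeneralLinearGroup.map ι₁))) (v : Fin 3 → ℂ),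
        v ∈ (Var.ballDatum hU h₃ (pmsCode L ι₁ V Γ') h').cone →
        (QuotientGroup.mk γ : ↥(Γ.Γ.map (Matrix.GeneralLinearGroup.map ι₁)) ⧸
            (Γ'.Γ.map (Matrix.GeneralLinearGroup.map ι₁)).subgroupOf
              (Γ.Γ.map (Matrix.GeneralLinearGroup.map ι₁))) • (Var.ballDatum hU h₃ (pmsCode L ι₁ V Γ') h').unif v =
          (Var.ballDatum hU h₃ (pmsCode L ι₁ V Γ') h').unif (((γ : GL (Fin 3) ℂ) : Matrix (Fin 3) (Fin 3) ℂ) *ᵥ v) := by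
  obtain ⟨f, hf⟩ := exists_levelCover hU h₃ hHD hle h' h
  obtain ⟨inst, c, hproj, _hF, hEnd, hact⟩ :=
    UnitaryBallLevelDeckCover.exists_finiteDeckCover_transferMap_hodge hHD hI (ballDatum_Hℂ_eq hU h₃ Γ Γ' h' h)
      (ballDatum_pmsCode_map_Γ hU h₃ Γ' h') (ballDatum_pmsCode_map_Γ hU h₃ Γ h) (Subgroup.map_mono hle)
      arapura2012_cor_15_4_6_holds f hf
  exact ⟨f, inst, c, hf, hproj, hEnd, hact⟩

/-- **(M1) for the Hecke operators of the tower of record.**  Same data; for every rational isometry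
`γ ∈ U(V)(L)` with `γ Γ' γ⁻¹ ≤ Γ` there is a Hecke leg `g : X_{Γ'} ⟶ X_Γ` over `[v] ↦ [γ^{ι₁} v]`
(`Model.exists_heckeTranslate`) and the Hecke operator `τ_c ∘ g^*` on `Hᵏ(X_Γ(ℂ); ℚ)` is a Hodge endomorphism of
the `ℚ`-Hodge structure of record — «Hecke operators are Hodge-compatible», as a theorem.
[cite: Shimura1971, §7.2–7.3] [cite: BergeronMillsonMoeglin2016Balls, Part 2 §1.8] -/
theorem exists_heckeOperator_mem_endAlg_ballDatum (hHD : exists_isReal_hodgeModel)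
    (hI : hodgePQ_independent_of_hodgeModel) {Γ Γ' : Level V} (hle : Γ'.Γ ≤ Γ.Γ)
    (h' : (pmsCode L ι₁ V Γ').IsAnisotropic) (h : (pmsCode L ι₁ V Γ).IsAnisotropic)
    [hN : ((Γ'.Γ.map (Matrix.GeneralLinearGroup.map ι₁)).subgroupOf
      (Γ.Γ.map (Matrix.GeneralLinearGroup.map ι₁))).Normal]
    [Fintype (↥(Γ.Γ.map (Matrix.GeneralLinearGroup.map ι₁)) ⧸
      (Γ'.Γ.map (Matrix.GeneralLinearGroup.map ι₁)).subgroupOf (Γ.Γ.map (Matrix.GeneralLinearGroup.map ι₁)))]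
    {γ : GL (Fin 3) L} (hγ : γ ∈ unitaryGroup (cmConjRingHom L) V.Hm)
    (hconj : Γ'.Γ.map (MulAut.conj γ).toMonoidHom ≤ Γ.Γ) (k : ℕ) :
    ∃ (f g : Var.scheme hU h₃ (.pms (pmsCode L ι₁ V Γ')) ⟶ Var.scheme hU h₃ (.pms (pmsCode L ι₁ V Γ)))
      (_ : MulAction (↥(Γ.Γ.map (Matrix.GeneralLinearGroup.map ι₁)) ⧸
          (Γ'.Γ.map (Matrix.GeneralLinearGroup.map ι₁)).subgroupOf (Γ.Γ.map (Matrix.GeneralLinearGroup.map ι₁)))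
        (ComplexPoints (Var.scheme hU h₃ (.pms (pmsCode L ι₁ V Γ')))))
      (c : FiniteDeckCover (↥(Γ.Γ.map (Matrix.GeneralLinearGroup.map ι₁)) ⧸
          (Γ'.Γ.map (Matrix.GeneralLinearGroup.map ι₁)).subgroupOf (Γ.Γ.map (Matrix.GeneralLinearGroup.map ι₁)))
        (ComplexPoints (Var.scheme hU h₃ (.pms (pmsCode L ι₁ V Γ'))))
        (ComplexPoints (Var.scheme hU h₃ (.pms (pmsCode L ι₁ V Γ))))),
      (∀ v ∈ (Var.ballDatum hU h₃ (pmsCode L ι₁ V Γ') h').cone,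
        AlgPoints.map f ((Var.ballDatum hU h₃ (pmsCode L ι₁ V Γ') h').unif v) =
          (Var.ballDatum hU h₃ (pmsCode L ι₁ V Γ) h).unif v) ∧
      (∀ v ∈ (Var.ballDatum hU h₃ (pmsCode L ι₁ V Γ') h').cone,
        AlgPoints.map g ((Var.ballDatum hU h₃ (pmsCode L ι₁ V Γ') h').unif v) =
          (Var.ballDatum hU h₃ (pmsCode L ι₁ V Γ) h).unif (((γ : Matrix (Fin 3) (Fin 3) L).map ι₁) *ᵥ v)) ∧
      c.proj = AlgPoints.mapContinuous (L := ℂ) f ∧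
      (c.transferMap (R := ℚ) k).hom ∘ₗ BettiUniverse.pull g k ∈
        (BettiUniverse.hodge hHD (Var.isSmoothProjective hU h₃ (.pms (pmsCode L ι₁ V Γ))) k).endAlg := by
  obtain ⟨f, inst, c, hf, hproj, hEnd, -⟩ := exists_levelDeckCover_hodge_ballDatum (hU := hU) (h₃ := h₃) hHD hI hle h' h
  obtain ⟨g, hg⟩ := exists_heckeTranslate hU h₃ hHD hγ hconj h' h
  exact ⟨f, g, inst, c, hf, hg, hproj, hEnd k g⟩

/-! ### A `ψ`-normal Hodge endomorphism of `Hᵏ(X_Γ(ℂ); ℚ)` is semisimple -/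

/-- **A `ψ`-normal Hodge endomorphism of `Hᵏ(X_Γ(ℂ); ℚ)` is semisimple** — the tree's
`Polarization.isSemisimple_of_isAdjointPair_of_commute` read on the realising surface: `ψ` a polarization of the
Hodge structure of record (one exists, `BettiUniverse.hodge_isPolarizable`), `T` a Hodge endomorphism (e.g. the
Hecke-shaped operator above) with a `ψ`-adjoint `T'` commuting with it.
[cite: Lange2023AbelianVarietiesC, §2.4.1 Prop. 2.4.2 and Thm. 2.4.9] -/
theorem isSemisimple_of_mem_endAlg_pms (hHD : exists_isReal_hodgeModel) (Γ : Level V) (k : ℕ)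
    (ψ : (BettiUniverse.hodge hHD (Var.isSmoothProjective hU h₃ (.pms (pmsCode L ι₁ V Γ))) k).Polarization)
    {T T' : Module.End ℚ (bettiCohomology (Var.scheme hU h₃ (.pms (pmsCode L ι₁ V Γ))) k)}
    (hT : T ∈ (BettiUniverse.hodge hHD (Var.isSmoothProjective hU h₃ (.pms (pmsCode L ι₁ V Γ))) k).endAlg)
    (hadj : LinearMap.IsAdjointPair ψ.form ψ.form T T') (hc : Commute T T') : T.IsSemisimple := by
  haveI := BettiUniverse.finite (Var.isSmoothProjective hU h₃ (.pms (pmsCode L ι₁ V Γ))) k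
  exact ψ.isSemisimple_of_isAdjointPair_of_commute hT hadj hc

end Tower

end Summit.HodgeConjecture.CorCM.Model

end
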